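import Summits.QuantumFields.BalabanUV.T4Continuum.Support.OutputRateFunctionalTablesTermwise
import Summits.QuantumFields.BalabanUV.T4Continuum.Support.OutputRateFunctionalTablesComplex

/-!
# OutputRateFunctionalTablesTermwiseEnds — Road D part 5: the STRUCTURE-FREE (`lip₂`) termwise END of the family model, and the
# COMPLEX-chart termwise ENDs behind the owner's Re∕Im reading (NE5 crux O1, owner R48-F ∕ R49; cell `pub-balaban`, T⁴ fan-out;
# `HOME/CLAIMS.log` INTENT l.17834; part 4 = `OutputRateFunctionalTablesTermwise`, the owner's g35-b = `OutputRateFunctionalTablesComplex`)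

Unit `b2b-balaban-t4-ne5-formalise-leaf-02` (NE5 formalisation swarm, leaf prover 02, gen 17).  Summits-side NEW WORK under the
LEAN PLACEMENT RULE (cell bookkeeping over ABSTRACT carriers on the EXISTING kernel; NOT a Literature module; nothing printed is
asserted, no `[cite:]` tag, no `Prop`-valued fact, no `def` at all).  HONEST FRAMING: rung (B)+1 of the FINITE-VOLUME T⁴ continuum
programme — NOT infinite volume, NOT a mass gap, NOT the Clay problem, NOT a proof of NE5 (NE5 is NOT PRINTED; cell GAPS
G-t4-U3-1).  HONEST DEPENDENCY (cell line, verbatim): continuum YM on T⁴ ⇐ BetaPertH ∧ nine spine estimates (0/9 proved);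
BetaPertH ⇐ (D1) ∧ (D4) ∧ CAP+tail; G-an2-4 gates asym, D1 and NE2/3/4.

WHY.  (a) Part 4's termwise END `FamilySlots.ne5_of_familySlots_termwise` runs through the kernel's STRUCTURAL closure
(`InsAffine ∧ InsBlind ∧ InsHomog ∧ InsScaleBound`).  On family slots whose insertions are built coordinatewise through part 2's
`famOf` (part 3's `PointwiseSlots.toFamilySlots`, the owner's `OutputRateFunctionalTablesComplexPointwise.toFamilySlotsRot`) the
identities `InsAffine`∕`InsHomog` do NOT follow from pointwise structure through `famOf`'s junk branch (a located typing fact of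
this lineage, gen 17; the same defect on the channel road is unit `…-leaf-06`'s D-ne5leaf06g12-1, repaired there by a linear
retraction).  The kernel already offers a closure that needs NO structure binder: `T4InputCauchyRateSpecies.ne5_at_of_stepModel_lip₂_nat`
consumes the summed binder `InsertionDampedNat` — junk-robust through `norm_famOf_sub_famOf_le` exactly as in part 3 — and the
species-Lipschitz form `DataLipschitz₂`, which the kernel derives from the two no-room fibre envelopes
(`dataLipschitz₂_of_fibreEnvelopesCl`), themselves derived from termwise data (`opFibreEnvelopeCl_of_termwise` ∕
`histFibreEnvelopeCl_of_termwise`).  §1 composes this with part 4's pointwise→family termwise transfers: SAME smallness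
`ω + G·c/(1 − ρ₀) < θ′`, SAME constant, no structure binder.  (b) The owner's RULING R49 (4) makes the COMPLEX chart
`𝒰 × Fin 2` the chart of record, Bałaban's one functional riding ROTATED on the two real rows (`hrot`: `S.Out k o h (X,(u,i)) =
(−I)^i · Out₀ k o h X`, `OutputRateFunctionalTablesComplex` §4); pointwise termwise data of `Out₀` (chart-free terms `T₀`) are
termwise data of the rotated functional (`HasSum.mul_left`, `‖(−I)^i‖ = 1`, `DifferentiableOn.const_mul`), so part 4's transfers
and the owner's `representsA∕B_reIm_of_complex` ∕ `decayBound_reImTab` ∕ `ne5_of_ne5_reImTab` compose to the (2.14)-roads' END on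
Road D-ℂ: §2, in the structural and in the structure-free form (owner l.17747: «welcome, yours∕successor's»).

WHAT ([folklore] bookkeeping, NO estimate; conclusions LITERALLY `T4OutputRate.NE5 EA EB W κ θ′ C₅` over the ORIGINAL carriers).
* §1 `FamilySlots.ne5_of_familySlots_termwise_lip` (nonempty chart onto the run-B backgrounds; binders = part 4's termwise END with
  the four structure∕single-scale binders replaced by `S.toStepModel.InsertionDampedNat W κ c ω`) and
  `PointwiseSlots.insertionDampedNat_of_pointwise_famOf` (that binder for part 3's per-background model from its per-background
  form, NO boundedness asked of the insertions — the Nat twin of part 3's `insertionDamped_of_pointwise`).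
* §2 for `S : FamilySlots C (𝒰 × Fin 2) Op Hist` with `hrot`: `ne5_of_familySlots_reIm_termwise` (structural) and
  `ne5_of_familySlots_reIm_termwise_lip` (structure-free) — COMPLEX representation identities of the two runs' term families
  `ℰA`∕`ℰB` at every chart point (two-row function tables READ), admissibility, the pointwise slack into a pointwise class,
  POINTWISE termwise data of `Out₀` on that class, the complex-domain decay bounds (printed KIND, [I] (1.18)), the pointwise rates,
  the insertion binders, the numerics, and a real SECTION `ι₀` on which the functionals of record are the Re-rows ⟹ NE5.
WHAT IS NOT HERE.  No instance (substrate cell, R34); no per-point (`PointwiseSlots`) packaging of §2 (the owner's g35-e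
`toFamilySlotsRot P` IS an `S` with `hrot := toFamilySlotsRot_out`); no estimate of [II].  0 sorry; axioms ⊆ {propext,
Classical.choice, Quot.sound}.
-/

noncomputable section

open scoped BigOperators ENNReal
open Finset Function Metric Set Complex

namespace Summit.QuantumFields.BalabanUV.T4Continuum.OutputRateFunctionalTablesTermwiseEnds

open Literature.MathematicalPhysics.QuantumFieldTheory.Balaban1983to89
open Literature.MathematicalPhysics.QuantumFieldTheory.Balaban1983to89.T4OutputRate
open Literature.MathematicalPhysics.QuantumFieldTheory.Balaban1983to89.T4InputCauchyRateData
open Literature.MathematicalPhysics.QuantumFieldTheory.Balaban1983to89.T4InputCauchyRateSpecies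
open Literature.MathematicalPhysics.QuantumFieldTheory.Balaban1983to89.T4InputCauchyRateTermwise
open Summit.QuantumFields.BalabanUV.T4Continuum.OutputRateFunctionalTables
open Summit.QuantumFields.BalabanUV.T4Continuum.OutputRateFunctionalTablesFamily
open Summit.QuantumFields.BalabanUV.T4Continuum.OutputRateFunctionalTablesPointwise
open Summit.QuantumFields.BalabanUV.T4Continuum.OutputRateFunctionalTablesComplex
open Summit.QuantumFields.BalabanUV.T4Continuum.OutputRateFunctionalTablesTermwise

variable {C : Carriers} {𝒰 : Type} {Op Hist : Type*} [NormedAddCommGroup Op] [NormedSpace ℂ Op] [NormedAddCommGroup Hist]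
  [NormedSpace ℂ Hist] {ι : Type*}

/-! ## §1 The structure-free termwise END of the family model -/

namespace FamilySlots

variable (S : FamilySlots C 𝒰 Op Hist)

/-- [folklore] **NE5 OVER `C` FROM FAMILY SLOTS WITH POINTWISE TERMWISE DATA — STRUCTURE-FREE (`lip₂`) FORM** (nonempty chart onto
the run-B backgrounds): the binders of part 4's `FamilySlots.ne5_of_familySlots_termwise` with `InsAffine ∧ InsBlind ∧ InsHomog` and
the pointwise single-scale bound REPLACED by the kernel's summed binder `S.toStepModel.InsertionDampedNat W κ c ω` (printed age
normalisation; junk-robust through `famOf` — part 3's device).  Route: pointwise termwise data ⟹ (part 4) termwise data of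
`S.toStepModel` on `famClass K` ⟹ (kernel) the two no-room fibre envelopes ⟹ `DataLipschitz₂ κ (G/(1−ρ₀)) (G/(1−ρ₀)) ρ₀` ⟹
`ne5_at_of_stepModel_lip₂_nat` ⟹ (part 1) `ne5_of_ne5_lift`.  SAME smallness `ω + G·c/(1 − ρ₀) < θ′` and SAME constant as the
structural END.  Nothing of the kernel re-proved. -/
theorem ne5_of_familySlots_termwise_lip [Nonempty 𝒰] {ρ : 𝒰 → C.BgB} (hρ : Surjective ρ) {EA : Functional C C.BgA}
    {EB : Functional C C.BgB} {W : Set (ℕ → ℝ)} {K : ℕ → (ℕ → ℝ) → 𝒰 → Set (Op × Hist)}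
    {T : ℕ → ι → Op → Hist → C.Dom × 𝒰 → ℂ} {a : ℕ → ι → ℝ} {κ G EA₀ E₀ δ δ' θ θ' c ω ρ₀ B : ℝ} {k₀ : ℕ}
    (hrA : S.toStepModel.RepresentsA (liftA ρ EA) W) (hrB : S.toStepModel.RepresentsB (liftB ρ EB) W)
    (hbase : S.toStepModel.InBase (liftB ρ EB) W)
    (hbox : ∀ k, ∀ g ∈ W, ∀ p ∈ S.Base k g, ∀ u : 𝒰,
      closedBall (p.1 u) (S.rOp k) ×ˢ closedBall (p.2 u) (S.rHist k) ⊆ K k g u)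
    (hrep : ∀ k, ∀ g ∈ W, ∀ (u : 𝒰) (q : Op × Hist), q ∈ K k g u → ∀ X : C.Dom, C.scale X = k →
      HasSum (fun i => T k i q.1 q.2 (X, u)) (S.Out k q.1 q.2 (X, u)))
    (hbd : ∀ k, ∀ g ∈ W, ∀ (u : 𝒰) (q : Op × Hist), q ∈ K k g u → ∀ X : C.Dom, C.scale X = k →
      ∀ i, ‖T k i q.1 q.2 (X, u)‖ ≤ a k i * Real.exp (-(κ * C.d X)))
    (hbud : TermBudget a G)
    (hline : ∀ k, ∀ g ∈ W, ∀ (w : 𝒰) (o u : Op) (h₀ v : Hist),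
      (∀ ζ ∈ closedBall (0 : ℂ) 1, (o + ζ • u, h₀ + ζ • v) ∈ K k g w) → ∀ X : C.Dom, C.scale X = k →
        ∀ i, DifferentiableOn ℂ (fun ζ : ℂ => T k i (o + ζ • u) (h₀ + ζ • v) (X, w)) (closedBall 0 1))
    (hdA : DecayBound EA W EA₀ κ) (hdB : DecayBound EB W E₀ κ)
    (hop : ∀ k, ∀ g ∈ W, ∀ u : 𝒰, ‖S.opA g k u - S.opB g k u‖ ≤ δ * θ ^ k * S.rOp k)
    (hins : ∀ k, ∀ g ∈ W, ∀ (t : C.Dom × 𝒰 → ℝ), (∀ Y u, |t (Y, u)| ≤ E₀ * Real.exp (-(κ * C.d Y))) →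
      ∀ u, ‖S.insA g k t u - S.insB g k t u‖ ≤ δ' * θ ^ k * S.rHist k)
    (hdamp : S.toStepModel.InsertionDampedNat W κ c ω)
    (hG : 0 ≤ G) (hδ : 0 ≤ δ) (hδ' : 0 ≤ δ') (hθ : 0 ≤ θ) (hθθ' : θ ≤ θ') (hθ'1 : θ' ≤ 1) (hc : 0 ≤ c)
    (hω : 0 < ω) (hρ₀ : ρ₀ < 1) (hnear : (δ + δ') * θ ^ k₀ + c * (EA₀ + E₀) / (1 - ω) ≤ ρ₀) (hB : 0 ≤ B)
    (hfirst : ∀ k < k₀, EA₀ + E₀ ≤ B * θ ^ k) (hsmall : ω + G / (1 - ρ₀) * c < θ') :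
    NE5 EA EB W κ θ' ((G / (1 - ρ₀) * δ + G / (1 - ρ₀) * δ' + B) * (θ' - ω) / (θ' - (ω + G / (1 - ρ₀) * c))) :=
  have hrep' := FamilySlots.termRep_of_pointwise S hrep
  have hbd' := FamilySlots.termBound_of_pointwise (C := C) hbd
  have hline' := FamilySlots.termLineAnalytic_of_pointwise (C := C) hline
  have hbox' := FamilySlots.boxInClass_of_pointwise S hbox
  ne5_of_ne5_lift hρ (ne5_at_of_stepModel_lip₂_nat S.toStepModel hrA hrB hbase
    (dataLipschitz₂_of_fibreEnvelopesCl (opFibreEnvelopeCl_of_termwise hbox' hrep' hbd' hbud hline')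
      (histFibreEnvelopeCl_of_termwise hbox' hrep' hbd' hbud hline') hρ₀)
    (decayBound_liftA_of ρ hdA) (decayBound_liftB_of ρ hdB) ((S.operatorRate_iff_pointwise W δ θ).2 hop)
    (S.insertionRate_of_pointwise hins) hdamp (div_nonneg hG (by linarith)) (div_nonneg hG (by linarith)) hδ hδ' hθ hθθ'
    hθ'1 hc hω hnear hB hfirst hsmall)

end FamilySlots

namespace PointwiseSlots

variable (P : PointwiseSlots C 𝒰 Op Hist)

/-- [folklore] **`InsertionDampedNat` OF PART 3's PER-BACKGROUND MODEL FROM ITS PER-BACKGROUND FORM** (nonempty chart) — junk-robust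
through `famOf` (`norm_famOf_sub_famOf_le`), NO boundedness asked of the insertions: the Nat twin of part 3's
`PointwiseSlots.insertionDamped_of_pointwise`, i.e. the binder §1's structure-free END consumes (the per-point hypothesis is the
shape unit `…-leaf-06`'s `InsertionChannelFamily` produces for a channel insertion). -/
theorem insertionDampedNat_of_pointwise_famOf [Nonempty 𝒰] {W : Set (ℕ → ℝ)} {κ c ω : ℝ}
    (h : ∀ k, ∀ g ∈ W, ∀ (t t' : C.Dom × 𝒰 → ℝ) (D : ℕ → ℝ), (∀ j < k, 0 ≤ D j) →
      (∀ Y, C.scale Y < k → ∀ u, |t (Y, u) - t' (Y, u)| ≤ D (C.scale Y) * Real.exp (-(κ * C.d Y))) →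
        ∀ u, ‖P.insA g k t u - P.insA g k t' u‖ ≤ P.rHist k * (c * ∑ j ∈ range k, ω ^ (k - 1 - j) * D j)) :
    P.toStepModel.InsertionDampedNat W κ c ω := by
  intro k g hg _ t t' D hD hb
  exact norm_famOf_sub_famOf_le (h k g hg t t' D hD fun Y hY u => hb (Y, u) hY)

end PointwiseSlots

/-! ## §2 The complex-chart termwise ENDs behind the owner's Re∕Im reading -/

section Complex

variable (S : FamilySlots C (𝒰 × Fin 2) Op Hist) (Out₀ : ℕ → Op → Hist → C.Dom → ℂ)

omit [NormedAddCommGroup Op] [NormedSpace ℂ Op] [NormedAddCommGroup Hist] [NormedSpace ℂ Hist] in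
/-- [folklore] Pointwise termwise data of Bałaban's functional `Out₀` are termwise data of the ROTATED functional `(−I)^i · Out₀`
with the rotated terms (`HasSum.mul_left`). -/
theorem hasSum_rot {T₀ : ℕ → ι → Op → Hist → C.Dom → ℂ} {k : ℕ} {o : Op} {h : Hist} {X : C.Dom} (i : Fin 2)
    (hs : HasSum (fun j => T₀ k j o h X) (Out₀ k o h X)) :
    HasSum (fun j => (-I) ^ (i : ℕ) * T₀ k j o h X) ((-I) ^ (i : ℕ) * Out₀ k o h X) :=
  hs.mul_left _

/-- [folklore] … with the same termwise majorants (`‖(−I)^i‖ = 1`). -/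
theorem norm_rot_le {z : ℂ} {b : ℝ} (i : Fin 2) (hz : ‖z‖ ≤ b) : ‖(-I) ^ (i : ℕ) * z‖ ≤ b := by
  rw [norm_mul, norm_negI_pow, one_mul]
  exact hz

/-- [folklore] **`T4OutputRate.NE5 EA EB` FROM THE Re∕Im FAMILY MODEL WITH POINTWISE TERMWISE DATA OF BAŁABAN's FUNCTIONAL —
STRUCTURAL FORM** (the (2.14)-roads' END on Road D-ℂ): family slots over `𝒰 × Fin 2` whose functional is the rotation of `Out₀`
(`hrot`); COMPLEX representation identities of the two runs' term families at every chart point (two-row function tables READ);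
admissibility; the pointwise slack into a pointwise class `K k g w`; the POINTWISE termwise data of `Out₀` on that class (`HasSum`,
majorants `a k i · e^{−κd}`, budget `G`, per-term disc analyticity along pointwise segments — chart-free terms `T₀`); the
complex-domain decay bounds of `ℰA`∕`ℰB`; the pointwise rates; the structure `InsAffine ∧ InsBlind ∧ InsHomog` of the family
insertion with the pointwise single-scale bound; the numerics; and a real SECTION `ι₀` on which the functionals of record are the
Re-rows ⟹ NE5 over the ORIGINAL carriers with the termwise END's constant.  `ne5_of_ne5_reImTab ∘
ne5_at_of_stepModel_termwise_slack_scale_nat ∘ part 4`; the owner's g35-e `toFamilySlotsRot P` is such an `S` (`hrot := by rfl`). -/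
theorem ne5_of_familySlots_reIm_termwise [Nonempty 𝒰] {ℰA ℰB : (ℕ → ℝ) → 𝒰 → C.Dom → ℂ} {EA : Functional C C.BgA}
    {EB : Functional C C.BgB} {W : Set (ℕ → ℝ)} {K : ℕ → (ℕ → ℝ) → 𝒰 × Fin 2 → Set (Op × Hist)}
    {T₀ : ℕ → ι → Op → Hist → C.Dom → ℂ} {a : ℕ → ι → ℝ} {κ G EA₀ E₀ E₁ δ δ' θ θ' c ω ρ₀ B : ℝ} {k₀ : ℕ}
    (hrot : ∀ k o h p, S.Out k o h p = (-I) ^ (p.2.2 : ℕ) * Out₀ k o h p.1)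
    (hrA : ∀ g ∈ W, ∀ (X : C.Dom) (u : 𝒰) (i : Fin 2), ℰA g u X =
      Out₀ (C.scale X) (S.opA g (C.scale X) (u, i)) (S.insA g (C.scale X) (tableA (reImTab (C := C) ℰA) g PUnit.unit) (u, i)) X)
    (hrB : ∀ g ∈ W, ∀ (X : C.Dom) (u : 𝒰) (i : Fin 2), ℰB g u X =
      Out₀ (C.scale X) (S.opB g (C.scale X) (u, i)) (S.insB g (C.scale X) (tableB (reImTab (C := C) ℰB) g PUnit.unit) (u, i)) X)
    (hbase : ∀ k, ∀ g ∈ W, (S.opB g k, S.insB g k (tableB (reImTab (C := C) ℰB) g PUnit.unit)) ∈ S.Base k g)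
    (hbox : ∀ k, ∀ g ∈ W, ∀ p ∈ S.Base k g, ∀ w : 𝒰 × Fin 2,
      closedBall (p.1 w) (S.rOp k) ×ˢ closedBall (p.2 w) (S.rHist k) ⊆ K k g w)
    (hrep : ∀ k, ∀ g ∈ W, ∀ (w : 𝒰 × Fin 2) (q : Op × Hist), q ∈ K k g w → ∀ X : C.Dom, C.scale X = k →
      HasSum (fun i => T₀ k i q.1 q.2 X) (Out₀ k q.1 q.2 X))
    (hbd : ∀ k, ∀ g ∈ W, ∀ (w : 𝒰 × Fin 2) (q : Op × Hist), q ∈ K k g w → ∀ X : C.Dom, C.scale X = k →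
      ∀ i, ‖T₀ k i q.1 q.2 X‖ ≤ a k i * Real.exp (-(κ * C.d X)))
    (hbud : TermBudget a G)
    (hline : ∀ k, ∀ g ∈ W, ∀ (w : 𝒰 × Fin 2) (o u : Op) (h₀ v : Hist),
      (∀ ζ ∈ closedBall (0 : ℂ) 1, (o + ζ • u, h₀ + ζ • v) ∈ K k g w) → ∀ X : C.Dom, C.scale X = k →
        ∀ i, DifferentiableOn ℂ (fun ζ : ℂ => T₀ k i (o + ζ • u) (h₀ + ζ • v) X) (closedBall 0 1))
    (hdA : ∀ g ∈ W, ∀ (u : 𝒰) (X : C.Dom), ‖ℰA g u X‖ ≤ EA₀ * Real.exp (-(κ * C.d X)))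
    (hdB : ∀ g ∈ W, ∀ (u : 𝒰) (X : C.Dom), ‖ℰB g u X‖ ≤ E₀ * Real.exp (-(κ * C.d X)))
    (hop : ∀ k, ∀ g ∈ W, ∀ w : 𝒰 × Fin 2, ‖S.opA g k w - S.opB g k w‖ ≤ δ * θ ^ k * S.rOp k)
    (hins : ∀ k, ∀ g ∈ W, ∀ (t : C.Dom × (𝒰 × Fin 2) → ℝ), (∀ Y w, |t (Y, w)| ≤ E₀ * Real.exp (-(κ * C.d Y))) →
      ∀ w, ‖S.insA g k t w - S.insB g k t w‖ ≤ δ' * θ ^ k * S.rHist k)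
    (haff : S.toStepModel.InsAffine W) (hblind : S.toStepModel.InsBlind W) (hhom : S.toStepModel.InsHomog W)
    (hunit : ∀ k, ∀ g ∈ W, ∀ (t : C.Dom × (𝒰 × Fin 2) → ℝ) (j : ℕ), j < k → (∀ Y w, C.scale Y ≠ j → t (Y, w) = 0) →
      (∀ Y, C.scale Y = j → ∀ w, |t (Y, w)| ≤ E₁ * Real.exp (-(κ * C.d Y))) →
        ∀ w, ‖S.insA g k t w - S.insA g k 0 w‖ ≤ S.rHist k * (c * (ω ^ (k - 1 - j) * E₁)))
    (hE₁ : 0 < E₁) (hG : 0 ≤ G) (hδ : 0 ≤ δ) (hδ' : 0 ≤ δ') (hθ : 0 ≤ θ) (hθθ' : θ ≤ θ') (hθ'1 : θ' ≤ 1) (hc : 0 ≤ c)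
    (hω : 0 < ω) (hρ₀ : ρ₀ < 1) (hnear : (δ + δ') * θ ^ k₀ + c * (EA₀ + E₀) / (1 - ω) ≤ ρ₀) (hB : 0 ≤ B)
    (hfirst : ∀ k < k₀, EA₀ + E₀ ≤ B * θ ^ k) (hsmall : ω + G / (1 - ρ₀) * c < θ')
    (ι₀ : C.BgB → 𝒰) (hιA : ∀ g ∈ W, ∀ (U : C.BgB) (X : C.Dom), EA g (C.transport U) X = (ℰA g (ι₀ U) X).re)
    (hιB : ∀ g ∈ W, ∀ (U : C.BgB) (X : C.Dom), EB g U X = (ℰB g (ι₀ U) X).re) :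
    NE5 EA EB W κ θ' ((G / (1 - ρ₀) * δ + G / (1 - ρ₀) * δ' + B) * (θ' - ω) / (θ' - (ω + G / (1 - ρ₀) * c))) :=
  ne5_of_ne5_reImTab ι₀ hιA hιB
    (ne5_at_of_stepModel_termwise_slack_scale_nat S.toStepModel (famClass K)
      (famTerm fun k i o h (p : C.Dom × (𝒰 × Fin 2)) => (-I) ^ (p.2.2 : ℕ) * T₀ k i o h p.1)
      (representsA_reIm_of_complex S Out₀ hrot hrA) (representsB_reIm_of_complex S Out₀ hrot hrB)
      (fun k g hg _ => hbase k g hg) (FamilySlots.boxInClass_of_pointwise S hbox)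
      (FamilySlots.termRep_of_pointwise S fun k g hg w q hq X hX => by
        rw [hrot]; exact hasSum_rot Out₀ w.2 (hrep k g hg w q hq X hX))
      (FamilySlots.termBound_of_pointwise (C := C) fun k g hg w q hq X hX i => norm_rot_le w.2 (hbd k g hg w q hq X hX i))
      hbud
      (FamilySlots.termLineAnalytic_of_pointwise (C := C) fun k g hg w o u h₀ v hseg X hX i =>
        (hline k g hg w o u h₀ v hseg X hX i).const_mul _)
      (decayBound_reImTab hdA) (decayBound_reImTab hdB) ((S.operatorRate_iff_pointwise W δ θ).2 hop)
      (S.insertionRate_of_pointwise hins) haff hblind hhom (FamilySlots.insScaleBound_of_pointwise S hunit) hE₁ hG hδ hδ' hθ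
      hθθ' hθ'1 hc hω hρ₀ hnear hB hfirst hsmall)

/-- [folklore] **THE SAME END IN THE STRUCTURE-FREE (`lip₂`) FORM**: `InsAffine ∧ InsBlind ∧ InsHomog` and the pointwise
single-scale bound REPLACED by `S.toStepModel.InsertionDampedNat W κ c ω` (junk-robust through `famOf` — the form the owner's
`toFamilySlotsRot P` of a `PointwiseSlots P` meets); route as in §1 on the complex chart, then `ne5_of_ne5_reImTab`.  SAME
smallness and constant. -/
theorem ne5_of_familySlots_reIm_termwise_lip [Nonempty 𝒰] {ℰA ℰB : (ℕ → ℝ) → 𝒰 → C.Dom → ℂ} {EA : Functional C C.BgA}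
    {EB : Functional C C.BgB} {W : Set (ℕ → ℝ)} {K : ℕ → (ℕ → ℝ) → 𝒰 × Fin 2 → Set (Op × Hist)}
    {T₀ : ℕ → ι → Op → Hist → C.Dom → ℂ} {a : ℕ → ι → ℝ} {κ G EA₀ E₀ δ δ' θ θ' c ω ρ₀ B : ℝ} {k₀ : ℕ}
    (hrot : ∀ k o h p, S.Out k o h p = (-I) ^ (p.2.2 : ℕ) * Out₀ k o h p.1)
    (hrA : ∀ g ∈ W, ∀ (X : C.Dom) (u : 𝒰) (i : Fin 2), ℰA g u X =
      Out₀ (C.scale X) (S.opA g (C.scale X) (u, i)) (S.insA g (C.scale X) (tableA (reImTab (C := C) ℰA) g PUnit.unit) (u, i)) X)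
    (hrB : ∀ g ∈ W, ∀ (X : C.Dom) (u : 𝒰) (i : Fin 2), ℰB g u X =
      Out₀ (C.scale X) (S.opB g (C.scale X) (u, i)) (S.insB g (C.scale X) (tableB (reImTab (C := C) ℰB) g PUnit.unit) (u, i)) X)
    (hbase : ∀ k, ∀ g ∈ W, (S.opB g k, S.insB g k (tableB (reImTab (C := C) ℰB) g PUnit.unit)) ∈ S.Base k g)
    (hbox : ∀ k, ∀ g ∈ W, ∀ p ∈ S.Base k g, ∀ w : 𝒰 × Fin 2,
      closedBall (p.1 w) (S.rOp k) ×ˢ closedBall (p.2 w) (S.rHist k) ⊆ K k g w)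
    (hrep : ∀ k, ∀ g ∈ W, ∀ (w : 𝒰 × Fin 2) (q : Op × Hist), q ∈ K k g w → ∀ X : C.Dom, C.scale X = k →
      HasSum (fun i => T₀ k i q.1 q.2 X) (Out₀ k q.1 q.2 X))
    (hbd : ∀ k, ∀ g ∈ W, ∀ (w : 𝒰 × Fin 2) (q : Op × Hist), q ∈ K k g w → ∀ X : C.Dom, C.scale X = k →
      ∀ i, ‖T₀ k i q.1 q.2 X‖ ≤ a k i * Real.exp (-(κ * C.d X)))
    (hbud : TermBudget a G)
    (hline : ∀ k, ∀ g ∈ W, ∀ (w : 𝒰 × Fin 2) (o u : Op) (h₀ v : Hist),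
      (∀ ζ ∈ closedBall (0 : ℂ) 1, (o + ζ • u, h₀ + ζ • v) ∈ K k g w) → ∀ X : C.Dom, C.scale X = k →
        ∀ i, DifferentiableOn ℂ (fun ζ : ℂ => T₀ k i (o + ζ • u) (h₀ + ζ • v) X) (closedBall 0 1))
    (hdA : ∀ g ∈ W, ∀ (u : 𝒰) (X : C.Dom), ‖ℰA g u X‖ ≤ EA₀ * Real.exp (-(κ * C.d X)))
    (hdB : ∀ g ∈ W, ∀ (u : 𝒰) (X : C.Dom), ‖ℰB g u X‖ ≤ E₀ * Real.exp (-(κ * C.d X)))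
    (hop : ∀ k, ∀ g ∈ W, ∀ w : 𝒰 × Fin 2, ‖S.opA g k w - S.opB g k w‖ ≤ δ * θ ^ k * S.rOp k)
    (hins : ∀ k, ∀ g ∈ W, ∀ (t : C.Dom × (𝒰 × Fin 2) → ℝ), (∀ Y w, |t (Y, w)| ≤ E₀ * Real.exp (-(κ * C.d Y))) →
      ∀ w, ‖S.insA g k t w - S.insB g k t w‖ ≤ δ' * θ ^ k * S.rHist k)
    (hdamp : S.toStepModel.InsertionDampedNat W κ c ω)
    (hG : 0 ≤ G) (hδ : 0 ≤ δ) (hδ' : 0 ≤ δ') (hθ : 0 ≤ θ) (hθθ' : θ ≤ θ') (hθ'1 : θ' ≤ 1) (hc : 0 ≤ c)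
    (hω : 0 < ω) (hρ₀ : ρ₀ < 1) (hnear : (δ + δ') * θ ^ k₀ + c * (EA₀ + E₀) / (1 - ω) ≤ ρ₀) (hB : 0 ≤ B)
    (hfirst : ∀ k < k₀, EA₀ + E₀ ≤ B * θ ^ k) (hsmall : ω + G / (1 - ρ₀) * c < θ')
    (ι₀ : C.BgB → 𝒰) (hιA : ∀ g ∈ W, ∀ (U : C.BgB) (X : C.Dom), EA g (C.transport U) X = (ℰA g (ι₀ U) X).re)
    (hιB : ∀ g ∈ W, ∀ (U : C.BgB) (X : C.Dom), EB g U X = (ℰB g (ι₀ U) X).re) :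
    NE5 EA EB W κ θ' ((G / (1 - ρ₀) * δ + G / (1 - ρ₀) * δ' + B) * (θ' - ω) / (θ' - (ω + G / (1 - ρ₀) * c))) :=
  have hrep' := FamilySlots.termRep_of_pointwise S (K := K)
    (T := fun k i o h (p : C.Dom × (𝒰 × Fin 2)) => (-I) ^ (p.2.2 : ℕ) * T₀ k i o h p.1) fun k g hg w q hq X hX => by
      rw [hrot]; exact hasSum_rot Out₀ w.2 (hrep k g hg w q hq X hX)
  have hbd' := FamilySlots.termBound_of_pointwise (C := C) (K := K)
    (T := fun k i o h (p : C.Dom × (𝒰 × Fin 2)) => (-I) ^ (p.2.2 : ℕ) * T₀ k i o h p.1) fun k g hg w q hq X hX i =>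
      norm_rot_le w.2 (hbd k g hg w q hq X hX i)
  have hline' := FamilySlots.termLineAnalytic_of_pointwise (C := C) (K := K)
    (T := fun k i o h (p : C.Dom × (𝒰 × Fin 2)) => (-I) ^ (p.2.2 : ℕ) * T₀ k i o h p.1) fun k g hg w o u h₀ v hseg X hX i =>
      (hline k g hg w o u h₀ v hseg X hX i).const_mul _
  have hbox' := FamilySlots.boxInClass_of_pointwise S hbox
  ne5_of_ne5_reImTab ι₀ hιA hιB (ne5_at_of_stepModel_lip₂_nat S.toStepModel (representsA_reIm_of_complex S Out₀ hrot hrA)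
    (representsB_reIm_of_complex S Out₀ hrot hrB) (fun k g hg _ => hbase k g hg)
    (dataLipschitz₂_of_fibreEnvelopesCl (opFibreEnvelopeCl_of_termwise hbox' hrep' hbd' hbud hline')
      (histFibreEnvelopeCl_of_termwise hbox' hrep' hbd' hbud hline') hρ₀)
    (decayBound_reImTab hdA) (decayBound_reImTab hdB) ((S.operatorRate_iff_pointwise W δ θ).2 hop)
    (S.insertionRate_of_pointwise hins) hdamp (div_nonneg hG (by linarith)) (div_nonneg hG (by linarith)) hδ hδ' hθ hθθ'
    hθ'1 hc hω hnear hB hfirst hsmall)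

end Complex

end Summit.QuantumFields.BalabanUV.T4Continuum.OutputRateFunctionalTablesTermwiseEnds

end
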